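import Summits.ValiantsHypothesis.ValiantsHypothesis.Theorems.BinomialElusivePeelingLemmaGadgetBlockPlus

/-!
# The block theta gadget, VI: rays and spiders of `S⁺` — tops and lone bottoms (§3g STEP 1)

Helper for the crux stmt-ValiantsHypothesis-7391 (negative lane; `Cruxes/PeelingLemma/DETERMINISTIC-ALLX.md`
§3g STEP 1).  The letter graph of the block gadget near `b` is a union of SPIDERS: the letter
`beta c` dies on arm `j` on the edge `2q - blockAge j c`, and the private letters above it on arm `j`
at the edges `≡ 2q - blockAge j c (mod 2q+1)` form the RAY of `c` on arm `j`; `S⁺` weights each edge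
by `a_j(t)` (`plus_apply_private`, `plus_apply_beta`).  Consequences: the top letter of the topmost
loaded edge of a ray reads exactly that edge's weight (`plus_top_of_ray`), and the bottom letter of
the lowest loaded edge of a ray whose sibling rays are unloaded at the centre reads exactly that
weight too (`plus_bottom_beta`, `plus_bottom_private`).  These are the `≥ 2` support letters per
loaded spider of §3g.  No Theses import.
-/

namespace Summit.ValiantsHypothesis.ValiantsHypothesis.Theorems.PeelingLemmaGadget

-- summit = sub-problem name (single-conjunct summit, D-0017 layout), so the namespace repeats it
set_option linter.dupNamespace false

open scoped BigOperators
open Finset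

variable {q R no : ℕ}

/-- **Top of a ray.**  If edge `t` of arm `j` (with `t ≤ no`, so that the letter born at its upper
end is private) is loaded and the next edge of its ray, `t + 2q + 1`, is not (or does not exist), then
the letter born at position `2q+t+1` reads exactly `a_j(t)` in `S⁺`. -/
theorem plus_top_of_ray (a : Fin 5 → ℕ → ℤ) (L : ℕ) (j : Fin 5) {t : ℕ} (ht : t ≤ no) (htL : t < L)
    (hnext : t + 2 * q + 1 < L → a j (t + 2 * q + 1) = 0) :
    (∑ j', ∑ t' ∈ Finset.range L, a j' t' *
        ((if birth3 q R no j' ((2 * q + t' + 1 : ℕ) : ℤ) = birth3 q R no j ((2 * q + (t + 1) : ℕ) : ℤ)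
            then 1 else 0) +
          (if birth3 q R no j' (t' : ℤ) = birth3 q R no j ((2 * q + (t + 1) : ℕ) : ℤ) then 1 else 0))) =
      a j t := by
  rw [plus_apply_private a L j (t₀ := t + 1) (by omega) (by omega) (by omega), Nat.add_sub_cancel]
  by_cases h : t + 1 + 2 * q < L
  · rw [if_pos h, show t + 1 + 2 * q = t + 2 * q + 1 by ring, hnext (by omega), add_zero]
  · rw [if_neg h, add_zero]

/-- **Bottom of a lone ray, private case.**  If edge `t` of arm `j` with `2q+1 ≤ t ≤ 2q+no+1` is
loaded and the previous edge of its ray, `t - 2q - 1`, is not, then the letter dying on edge `t`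
(born at position `t`, private) reads exactly `a_j(t)`. -/
theorem plus_bottom_private (a : Fin 5 → ℕ → ℤ) (L : ℕ) (j : Fin 5) {t : ℕ} (h1 : 2 * q + 1 ≤ t)
    (h2 : t ≤ 2 * q + no + 1) (htL : t < L) (hprev : a j (t - 2 * q - 1) = 0) :
    (∑ j', ∑ t' ∈ Finset.range L, a j' t' *
        ((if birth3 q R no j' ((2 * q + t' + 1 : ℕ) : ℤ) = birth3 q R no j ((2 * q + (t - 2 * q) : ℕ) : ℤ)
            then 1 else 0) +
          (if birth3 q R no j' (t' : ℤ) = birth3 q R no j ((2 * q + (t - 2 * q) : ℕ) : ℤ) then 1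
            else 0))) = a j t := by
  rw [plus_apply_private a L j (t₀ := t - 2 * q) (by omega) (by omega) (by omega),
    show t - 2 * q - 1 = t - 2 * q - 1 from rfl, hprev, zero_add, if_pos (by omega)]
  congr 1; omega

/-- The position `t` as an integer equals `2q + (t - 2q)` for `t ≥ 2q` (to read `plus_bottom_private`
at the letter `birth3 j t`). -/
theorem birth3_pos_eq (j : Fin 5) {t : ℕ} (h : 2 * q ≤ t) :
    birth3 q R no j (t : ℤ) = birth3 q R no j ((2 * q + (t - 2 * q) : ℕ) : ℤ) := by
  congr 1; push_cast; omega

/-- **Bottom of a lone ray, centre case.**  If the edge `2q - blockAge j c` of arm `j` (on which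
`beta c` dies) is loaded and on every other arm the edge on which `beta c` dies is unloaded, then
`beta c` reads exactly `a_j(2q - blockAge j c)`. -/
theorem plus_bottom_beta (a : Fin 5 → ℕ → ℤ) (L : ℕ) (hL : 2 * q < L) (j : Fin 5) (c : Fin (2 * q + 1))
    (hothers : ∀ j', j' ≠ j → a j' (2 * q - ((blockAge q R j' c : Fin (2 * q + 1)) : ℕ)) = 0) :
    (∑ j', ∑ t' ∈ Finset.range L, a j' t' *
        ((if birth3 q R no j' ((2 * q + t' + 1 : ℕ) : ℤ) = GLetter.beta c then 1 else 0) +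
          (if birth3 q R no j' (t' : ℤ) = GLetter.beta c then 1 else 0))) =
      a j (2 * q - ((blockAge q R j c : Fin (2 * q + 1)) : ℕ)) := by
  rw [plus_apply_beta a L hL c, Finset.sum_eq_single_of_mem j (Finset.mem_univ j)]
  exact fun j' _ hj => hothers j' hj

/-- The ray index of an edge: edge `t` of arm `j` lies on the ray of `beta (rayIdx j t)`, i.e.
`2q - blockAge j (rayIdx j t) = t % (2q+1)`. -/
theorem exists_ray_index (j : Fin 5) (t : ℕ) :
    ∃ c : Fin (2 * q + 1), 2 * q - ((blockAge q R j c : Fin (2 * q + 1)) : ℕ) = t % (2 * q + 1) := by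
  have hlt : t % (2 * q + 1) < 2 * q + 1 := Nat.mod_lt _ (by omega)
  refine ⟨blockAge q R j ⟨2 * q - t % (2 * q + 1), by omega⟩, ?_⟩
  rw [blockAge_blockAge]
  simp only
  omega

/-- Two edges `t`, `t'` of arm `j` lie on the same ray iff `t ≡ t' (mod 2q+1)`: the ray index is
determined by the residue. -/
theorem ray_index_unique (j : Fin 5) {c c' : Fin (2 * q + 1)} {t : ℕ}
    (hc : 2 * q - ((blockAge q R j c : Fin (2 * q + 1)) : ℕ) = t % (2 * q + 1))
    (hc' : 2 * q - ((blockAge q R j c' : Fin (2 * q + 1)) : ℕ) = t % (2 * q + 1)) : c = c' := by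
  have h1 := (blockAge q R j c).isLt
  have h2 := (blockAge q R j c').isLt
  have : blockAge q R j c = blockAge q R j c' := Fin.ext (by omega)
  have := congrArg (blockAge q R j) this
  rwa [blockAge_blockAge, blockAge_blockAge] at this

end Summit.ValiantsHypothesis.ValiantsHypothesis.Theorems.PeelingLemmaGadget
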